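import Summits.Langlands.Langlands.Theses.QuadraticWindow

/-!
# Route QuadraticWindow — Assembly (item stmt-Langlands-3203)

The assembly item of route `QuadraticWindow` for the Langlands summit:
`HostInducedRep → TwistUnpackaging → BeyondTheWindow → Langlands`.

The glue carries no mathematics by design (D-0019 thin route): its only content is
"cruxes ⟹ X", i.e. `HostInducedRep → TwistUnpackaging → QuadraticWindowA`, which is pure
instantiation — the `ψ`-family hypothesis of `TwistUnpackaging` (existence of the induced
packages `R_ψ : Γ_{F₀} → GL_{2n}(ℚ̄_ℓ)` for every admissible finite-order twist `ψ`) is exactly the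
conclusion of `HostInducedRep`, and the conclusion of `TwistUnpackaging` is the conclusion of the
target `QuadraticWindowA`.  The residual `BeyondTheWindow := QuadraticWindowA → Langlands` then
gives the summit statement.  This is literally the shape of the route file's deciding theorem
`Summit.Langlands.Langlands.Theses.QuadraticWindow.closes`.
-/

set_option linter.dupNamespace false -- project-wide option (lakefile weak.linter.dupNamespace); `Summit.Langlands.Langlands` is the mandated namespace

namespace Summit.Langlands.Langlands.Theorems.QuadraticWindow

open Summit.Langlands.Langlands.Theses.QuadraticWindow

/-- **Cruxes ⟹ target.** `HostInducedRep → TwistUnpackaging → QuadraticWindowA`: for `F₀` totally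
real, `F/F₀` quadratic with nontrivial automorphism `τ`, `π` cuspidal regular algebraic on `GL_n/F`,
`τ`-polarized a.e. with respect to the Artin avatar `e` and the norm exponent `k`, parity-normalised
and not `τ`-invariant, `ℓ ∤ disc F` with `π` unramified above `ℓ`: the host engine `HostInducedRep`
supplies, for every admissible twist avatar `eψ`, the induced package `R_ψ` with controlled
unramified Frobenius characteristic polynomials, which is precisely the family hypothesis of the
extraction crux `TwistUnpackaging`; its conclusion is the Galois representation `ρ : Γ_F → GL_n(ℚ̄_ℓ)`
with cofinite Satake–Frobenius matching demanded by `QuadraticWindowA`.  Pure logic. -/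
theorem quadraticWindowA_of_cruxes (host : HostInducedRep) (unpack : TwistUnpackaging) :
    QuadraticWindowA := by
  intro F₀ F _ _ _ _ _ τ hTR hdeg hτ n hcpt π e k hreg hpol hpar hodd hnti ℓ _ ι hℓ hunr
  exact unpack F₀ F τ hTR hdeg hτ n hcpt π e k hreg hpol hpar hodd hnti ℓ ι hℓ hunr
    fun eψ h₁ h₂ h₃ => host F₀ F τ hTR hdeg hτ n hcpt π e k hreg hpol hpar hodd ℓ ι hℓ hunr eψ h₁ h₂ h₃

/-- **Assembly of route QuadraticWindow** (item stmt-Langlands-3203).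
`HostInducedRep → TwistUnpackaging → BeyondTheWindow → Langlands`: apply the residual
`BeyondTheWindow : QuadraticWindowA → Langlands` to the target `QuadraticWindowA`, which follows
from the two cruxes by instantiation (`quadraticWindowA_of_cruxes`). -/
theorem Assembly_proof : Summit.Langlands.Langlands.Theses.QuadraticWindow.Assembly := by
  unfold Summit.Langlands.Langlands.Theses.QuadraticWindow.Assembly
  intro host unpack beyond
  exact beyond (quadraticWindowA_of_cruxes host unpack)

end Summit.Langlands.Langlands.Theorems.QuadraticWindow
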